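import Summits.NavierStokesRegularity.NavierStokesRegularity.Theorems.TerminalTraceTypeITraceScarL3ExtinctApexZoomDataConst
import Summits.NavierStokesRegularity.NavierStokesRegularity.Theorems.TerminalTraceTypeITraceScarL3LogMeanZoomTransfer
import Summits.NavierStokesRegularity.NavierStokesRegularity.Theorems.TerminalTraceTypeITraceScarL3LogMeanApexAEConsequences
import Literature.Analysis.FluidPDE.LocalPlainPressureBound
import HarnessLib

/-!
# T28-C «CEILING AND MEAN» AT UNIT VISCOSITY (ROUND-28 §3; item `TerminalTrace.TypeITraceScarL3`,
# stmt-NavierStokesRegularity-18385, Stub LOUD line; helpers): a Type-I blow-up whose rate at `x₀` has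
# LOG-WINDOW MEANS `q < 1` leaves no `L³` scar at `x₀`

Seat nsreg-C26-p1 g2 (cell ns-regularity-ideate), `--supports stmt-NavierStokesRegularity-18385` (helper);
planner-of-record nsreg-p2 g29 (ROUND-28 §3 T28-C), DIRECTOR-NS #130 (2).

* `extinctApexD_of_L3trace_unit_lm` — `extinctApexD_of_L3trace_unit_const` (the constant-exposed Stub 2′ at
  unit viscosity: classical `(u, p)` on `[0,T)`, Leray–Hopf, eventual rate `C/√(T−t)`, NOT backward bounded at
  `(T, x₀)`, `u(T) ∈ L³(B(x₀, ρ))` ⟹ an extinct Type-I apex package `(U, P, G, M, D₀)` of class `(M, D₀, C)`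
  backward singular at the origin) RE-RUN VERBATIM with ONE MORE DATUM carried through the zoom: a measurable
  local rate `b` at `x₀` (`‖u(t, x)‖ ≤ b(t)` for `T − δ_b < t < T`, `|x − x₀| < ρ_b`) with the LOG-MEAN bound
  `∫⁻_{]t',t[} b² ≤ ofReal(2q·log((T−t')/(T−t)) + K₀)`; the package then carries an a.e. rate `β` on the
  lower slab with `∫⁻_{]s',s[} β² ≤ ofReal(2q·log((−s')/(−s)) + K₀)` (`exists_aeLogMeanRate_of_zoomData`).
* **`not_memLp_three_of_logMean_lt_one_unit`** — T28-C at `ν = 1`: under the same hypotheses with `q < 1`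
  (and `K₀ ≥ 0`), `u(T) ∉ L³(B(x₀, ρ))` for every `ρ > 0`.  Proof: the package above is backward singular at
  the origin, against `no_topSingular_of_aeLogMean_lt_one` (T28-B from an a.e. rate, `…LogMeanApexAEConsequences`).
  The constant window T27-C (`C² < 2`) is the special case `b = C/√(T−t)`, `q = C²/2`, `K₀ = 0`.

WHAT THIS IS NOT: not Stub LOUD (all rates), not item 18385 for every Type-I blow-up, NOT a proof of
Navier–Stokes regularity — a statement about hypothetical blow-ups whose rate at the singular point has
log-window means below `1` (unit viscosity).  [folklore; Ghidaglia 1986; Agmon–Nirenberg 1967;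
AlbrittonBarker2019 §3; SereginSverak2009 (as13); WangZhang2016 §4; Seregin2014 §6.6; CaffarelliKohnNirenberg1982]
-/

noncomputable section

set_option linter.dupNamespace false

namespace Summit.NavierStokesRegularity.NavierStokesRegularity.Theorems.TypeITraceScarL3

open MeasureTheory Set Function Filter Topology TopologicalSpace Metric
open Literature.Analysis.FluidPDE
open scoped NNReal ENNReal InnerProductSpace RealInnerProductSpace

/-- **The constant-exposed Stub 2′ at unit viscosity carrying a log-mean rate datum** (module docstring).
[folklore; AlbrittonBarker2019 §3; SereginSverak2009 (as13); WangZhang2016 §4; Seregin2014 §6.6] -/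
theorem extinctApexD_of_L3trace_unit_lm {T : ℝ} (hT : 0 < T)
    {u : ℝ → EuclideanSpace ℝ (Fin 3) → EuclideanSpace ℝ (Fin 3)} {p : ℝ → EuclideanSpace ℝ (Fin 3) → ℝ}
    (hsol : IsClassicalNSSolutionOn (Ico 0 T) 1 0 u p) (hLH : IsLerayHopfOn T 1 0 (u 0) u)
    {C : ℝ} (hC0 : 0 ≤ C) (hrateT : ∀ᶠ t in 𝓝[<] T, ∀ x, ‖u t x‖ ≤ C / Real.sqrt (T - t))
    (x₀ : EuclideanSpace ℝ (Fin 3)) (hnotbd : ¬ IsBackwardBoundedAt u T x₀)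
    {ρ : ℝ} (hρ : 0 < ρ) (htr : MemLp (u T) 3 (volume.restrict (ball x₀ ρ)))
    {b : ℝ → ℝ} (hbm : Measurable b) {δb ρb q K₀ : ℝ} (hδb : 0 < δb) (hρb : 0 < ρb)
    (hb : ∀ t ∈ Ioo (T - δb) T, ∀ x ∈ ball x₀ ρb, ‖u t x‖ ≤ b t)
    (hLM : ∀ t' t : ℝ, T - δb < t' → t' ≤ t → t < T →
      ∫⁻ τ in Ioo t' t, ENNReal.ofReal (b τ ^ 2) ≤
        ENNReal.ofReal (2 * q * Real.log ((T - t') / (T - t)) + K₀)) :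
    ∃ (U : ℝ → EuclideanSpace ℝ (Fin 3) → EuclideanSpace ℝ (Fin 3)) (P : ℝ → EuclideanSpace ℝ (Fin 3) → ℝ)
      (G : ℝ → EuclideanSpace ℝ (Fin 3) → EuclideanSpace ℝ (Fin 3) →L[ℝ] EuclideanSpace ℝ (Fin 3))
      (M D₀ : ℝ≥0),
      (∀ a : ℝ, 0 < a → IsSuitableWeakSolutionInBall a (0 : ℝ × EuclideanSpace ℝ (Fin 3)) U P) ∧
      (∀ a : ℝ, 0 < a →
        HasWeakSpatialGradientOn (parabolicCylinderOpens a (0 : ℝ × EuclideanSpace ℝ (Fin 3))) U G) ∧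
      (∀ a : ℝ, 0 < a → typeIBound (parabolicCylinder a (0 : ℝ × EuclideanSpace ℝ (Fin 3))) U P G ≤ M) ∧
      (∀ z₀ : ℝ × EuclideanSpace ℝ (Fin 3), z₀.1 ≤ 0 → ∀ r : ℝ, 0 < r → cknD r z₀ P ≤ D₀) ∧
      (∀ s : ℝ, s < 0 → ∀ᵐ y : EuclideanSpace ℝ (Fin 3), ‖U s y‖ ≤ C / Real.sqrt (-s)) ∧
      (∀ φ : EuclideanSpace ℝ (Fin 3) → EuclideanSpace ℝ (Fin 3), ContDiff ℝ (⊤ : ℕ∞) φ →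
        HasCompactSupport φ → ∀ ε : ℝ, 0 < ε →
          ∃ s₀ : ℝ, s₀ < 0 ∧ ∀ᵐ s ∂(volume.restrict (Ioo s₀ 0)), |∫ y, ⟪U s y, φ y⟫| ≤ ε) ∧
      IsBackwardSingularPoint U (0 : ℝ × EuclideanSpace ℝ (Fin 3)) ∧
      ∃ β : ℝ → ℝ,
        (∀ᵐ z ∂(volume.restrict (Iio (0 : ℝ) ×ˢ (univ : Set (EuclideanSpace ℝ (Fin 3))))),
          ‖U z.1 z.2‖ ≤ β z.1) ∧
        ∀ s' s : ℝ, s' ≤ s → s < 0 →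
          ∫⁻ σ in Ioo s' s, ENNReal.ofReal (β σ ^ 2) ≤
            ENNReal.ofReal (2 * q * Real.log ((-s') / (-s)) + K₀) := by
  -- ## (1) the apex with its zoom data (constant exposed); then verbatim `extinctApexD_of_L3trace_unit`
  have hI : IsTypeIBlowup u T := ⟨C, hrateT⟩
  obtain ⟨μ, U, P, G, M, hμ, hμ0, h1, h2, h3, h4, h5, h6, hdata⟩ :=
    exists_extinctApex_zoomData_unit_const hT hsol hLH hC0 hrateT x₀ hnotbd hρ htr
  -- ## (1') the log-mean datum passes to the limit `U`
  obtain ⟨βr, hβr, hβwin⟩ := exists_aeLogMeanRate_of_zoomData hT hsol.smooth_velocity.continuousOn x₀ hbm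
    hδb hρb hb hLM hμ hμ0 (U := U)
    (fun a ha => ⟨(hdata a ha).1.aestronglyMeasurable, (hdata a ha).2.2.1⟩)
  -- ## (2) the vertex frame: `v = R u(T + R²·, x₀ + R·)`, `πv = R² q(…)`, with `𝐈(Q(0,1/2)) < ⊤`
  obtain ⟨r₀, M₀, T₁, hr₀, hT₁, hMor⟩ := morrey_of_typeI one_pos hT hsol hLH hI
  obtain ⟨R, α, β, hR, hα, hβ, hβeq, hαeq, hβT, hball, hGv, htypeI⟩ :=
    exists_zoom_typeIBound_lt_top_of_morrey one_pos hT hsol hLH hr₀ hT₁ hMor x₀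
  rw [div_one] at hβeq hαeq
  set q : ℝ → EuclideanSpace ℝ (Fin 3) → ℝ :=
    fun t x => p t x - (p t 0 - normalisedPressure (u t) 0) with hq
  set v : ℝ → EuclideanSpace ℝ (Fin 3) → EuclideanSpace ℝ (Fin 3) := α • stPull β R T x₀ u with hv
  set πv : ℝ → EuclideanSpace ℝ (Fin 3) → ℝ := α ^ 2 • stPull β R T x₀ q with hπv
  set Gv : ℝ → EuclideanSpace ℝ (Fin 3) → EuclideanSpace ℝ (Fin 3) →L[ℝ] EuclideanSpace ℝ (Fin 3) :=
    (α * R) • stPull β R T x₀ (fun t x => fderiv ℝ (u t) x) with hGvdef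
  have hπv1 : πv = R ^ 2 • stPull (R ^ 2) R T x₀ q := by rw [hπv, hαeq, hβeq]
  set z₀ : ℝ × EuclideanSpace ℝ (Fin 3) := ((0 : ℝ), (0 : EuclideanSpace ℝ (Fin 3))) with hz₀
  have hz₀0 : z₀ = 0 := rfl
  -- the distributional pair on `Q(0,1)` and the sub-cylinder `Q(0, 1/2)`
  have hdist : IsDistributionalNSSolutionOn
      (parabolicCylinderOpens 1 (0 : ℝ × EuclideanSpace ℝ (Fin 3))) 1 0 v πv := hball.1.distributional
  have hsub : parabolicCylinder (1 / 2) z₀ ⊆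
      ((parabolicCylinderOpens 1 (0 : ℝ × EuclideanSpace ℝ (Fin 3)) :
        Opens (ℝ × EuclideanSpace ℝ (Fin 3))) : Set (ℝ × EuclideanSpace ℝ (Fin 3))) := by
    rw [coe_parabolicCylinderOpens, hz₀0]
    exact SuitableCompactness.parabolicCylinder_zero_mono (by norm_num) (by norm_num)
  -- `M₁ = 𝐈(Q(0, 1/2))` bounds `C` on every sub-cylinder
  set M₁ : ℝ≥0∞ := typeIBound (parabolicCylinder (1 / 2) (0 : ℝ × EuclideanSpace ℝ (Fin 3))) v πv Gv
    with hM₁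
  have hM₁top : M₁ ≠ ⊤ := htypeI.ne
  have hC : ∀ (z : ℝ × EuclideanSpace ℝ (Fin 3)) (r : ℝ), 0 < r →
      parabolicCylinder r z ⊆ parabolicCylinder (1 / 2) z₀ → cknC r z v ≤ M₁ := by
    intro z r hr hz
    rw [hz₀0] at hz
    exact cknC_le_of_typeIBound_le (le_refl M₁) subset_rfl hr hz
  -- `M₂ = D(Q(0, 1/2))[πv]` is finite (`πv ∈ L^{3/2}(Q(0,1))`)
  set M₂ : ℝ≥0∞ := cknD (1 / 2) z₀ πv with hM₂
  have hM₂top : M₂ ≠ ⊤ := by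
    obtain ⟨h32, h32', h32r⟩ := threeHalves_facts
    have hm : MemLp (uncurry πv) (3 / 2)
        (volume.restrict (parabolicCylinder 1 (0 : ℝ × EuclideanSpace ℝ (Fin 3)))) := hball.2.2.2
    have h2 := hm.2
    rw [eLpNorm_eq_lintegral_rpow_enorm_toReal (by norm_num) h32', h32r] at h2
    have hfin : ∫⁻ z in parabolicCylinder 1 (0 : ℝ × EuclideanSpace ℝ (Fin 3)),
        ‖uncurry πv z‖ₑ ^ (3 / 2 : ℝ) < ⊤ := by
      by_contra htop
      rw [not_lt, top_le_iff] at htop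
      rw [htop, ENNReal.top_rpow_of_pos (by norm_num)] at h2
      exact lt_irrefl _ h2
    have hfin' : ∫⁻ z in parabolicCylinder (1 / 2) z₀, ‖πv z.1 z.2‖ₑ ^ (3 / 2 : ℝ) < ⊤ := by
      refine lt_of_le_of_lt (lintegral_mono_set ?_) hfin
      rw [hz₀0]
      exact SuitableCompactness.parabolicCylinder_zero_mono (by norm_num) (by norm_num)
    rw [hM₂, cknD]
    exact ENNReal.mul_ne_top (ENNReal.inv_ne_top.2 (pow_ne_zero _ (by simp))) hfin'.ne
  -- ## (3) Seregin–Šverák's iterated pressure decay: plain `D ≤ κ(M₁ + M₂)` on the window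
  obtain ⟨κ, hκ⟩ := exists_cknD_le_window_of_cknC_le
  set K : ℝ≥0∞ := κ * (M₁ + M₂) with hK
  have hKtop : K ≠ ⊤ := ENNReal.mul_ne_top ENNReal.coe_ne_top (ENNReal.add_ne_top.2 ⟨hM₁top, hM₂top⟩)
  have hwin : ∀ z : ℝ × EuclideanSpace ℝ (Fin 3), z.1 ≤ z₀.1 → z₀.1 - 3 / 16 ≤ z.1 →
      dist z.2 z₀.2 < 1 / 4 → ∀ r ∈ Ioc (0 : ℝ) (1 / 4), cknD r z πv ≤ K := by
    intro z hz1 hz2 hz3 r hr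
    have h := hκ (parabolicCylinderOpens 1 (0 : ℝ × EuclideanSpace ℝ (Fin 3))) v πv hdist z₀ (1 / 2)
      (by norm_num) hsub M₁ M₂ hC le_rfl z hz1 (by norm_num at hz2 ⊢; linarith) (by norm_num; exact hz3)
      r ⟨hr.1, by norm_num; exact hr.2⟩
    rw [hK]
    exact h
  -- ## (4) the zoomed pressures of the zoom data are `(μ_j/R)`-zooms of `πv`
  set lam : ℕ → ℝ := fun j => μ j / R with hlam
  have hlampos : ∀ j, 0 < lam j := fun j => show 0 < μ j / R from div_pos (hμ j) hR
  have hlam0 : Tendsto lam atTop (𝓝 0) := by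
    have := hμ0.div_const R
    rwa [zero_div] at this
  have hzoomπ : ∀ j, (lam j) ^ 2 • stPull ((lam j) ^ 2) (lam j) z₀.1 z₀.2 πv =
      (μ j) ^ 2 • stPull ((μ j) ^ 2) (μ j) T x₀ q := by
    intro j
    have e : lam j * R = μ j := by rw [hlam]; field_simp
    show (lam j) ^ 2 • stPull ((lam j) ^ 2) (lam j) (0 : ℝ) (0 : EuclideanSpace ℝ (Fin 3)) πv = _
    rw [hπv1, zoom_zoom_pressure, e]
  have hpm : AEStronglyMeasurable (uncurry πv) (volume.restrict (parabolicCylinder (1 / 2) z₀)) :=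
    hball.2.2.2.1.mono_measure (Measure.restrict_mono (by rwa [coe_parabolicCylinderOpens] at hsub) le_rfl)
  have hπ : ∀ a : ℝ, 0 < a → MemLp (uncurry P) (3 / 2)
      (volume.restrict (parabolicCylinder a (0 : ℝ × EuclideanSpace ℝ (Fin 3)))) :=
    fun a ha => (hdata a ha).2.1
  have hweak : ∀ a : ℝ, 0 < a → ∀ g : ℝ × EuclideanSpace ℝ (Fin 3) → ℝ,
      MemLp g 3 (volume.restrict (parabolicCylinder a (0 : ℝ × EuclideanSpace ℝ (Fin 3)))) →
      Tendsto (fun j => ∫ w' in parabolicCylinder a (0 : ℝ × EuclideanSpace ℝ (Fin 3)),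
          ((lam j) ^ 2 • stPull ((lam j) ^ 2) (lam j) z₀.1 z₀.2 πv) w'.1 w'.2 * g w')
        atTop (𝓝 (∫ w' in parabolicCylinder a (0 : ℝ × EuclideanSpace ℝ (Fin 3)), P w'.1 w'.2 * g w')) := by
    intro a ha g hg
    simp only [hzoomπ]
    exact (hdata a ha).2.2.2 g hg
  -- ## (5) weak lower semicontinuity: the limit pressure inherits `D ≤ K` at every apex
  have hvi : ∀ z : ℝ × EuclideanSpace ℝ (Fin 3), z.1 ≤ 0 → ∀ r : ℝ, 0 < r → cknD r z P ≤ K :=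
    fun z hz r hr => blowup_cknD_le_apex_of_tendsto hpm (by norm_num : (0 : ℝ) < 3 / 16)
      (by norm_num : (0 : ℝ) < 1 / 4) (by norm_num : (0 : ℝ) < 1 / 4) hwin hlampos hlam0 hπ hweak hz hr
  -- ## (6) assemble, with `D₀ = K` as a finite constant
  refine ⟨U, P, G, M, K.toNNReal, h1, h2, h3, ?_, h4, h5, h6, βr, hβr, hβwin⟩
  intro z hz r hr
  rw [ENNReal.coe_toNNReal hKtop]
  exact hvi z hz r hr

/-- **T28-C at unit viscosity** (module docstring): a classical Leray–Hopf flow on `[0,T)` (`ν = 1`) with an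
eventual Type-I rate (ANY constant `C`), NOT backward bounded at `(T, x₀)`, whose rate on a ball about `x₀` has
log-window means `q < 1` — `‖u(t, x)‖ ≤ b(t)` (`T − δ_b < t < T`, `|x − x₀| < ρ_b`, `b` measurable) with
`∫⁻_{]t',t[} b² ≤ ofReal(2q·log((T−t')/(T−t)) + K₀)`, `K₀ ≥ 0` — has `u(T) ∉ L³(B(x₀, ρ))` for every `ρ > 0`.
NOT a regularity theorem: a statement about hypothetical blow-ups.
[folklore; Ghidaglia 1986; Agmon–Nirenberg 1967; CaffarelliKohnNirenberg1982 Thm B; Seregin2014 §6.6] -/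
theorem not_memLp_three_of_logMean_lt_one_unit {T : ℝ} (hT : 0 < T)
    {u : ℝ → EuclideanSpace ℝ (Fin 3) → EuclideanSpace ℝ (Fin 3)} {p : ℝ → EuclideanSpace ℝ (Fin 3) → ℝ}
    (hsol : IsClassicalNSSolutionOn (Ico 0 T) 1 0 u p) (hLH : IsLerayHopfOn T 1 0 (u 0) u)
    {C : ℝ} (hC0 : 0 ≤ C) (hrateT : ∀ᶠ t in 𝓝[<] T, ∀ x, ‖u t x‖ ≤ C / Real.sqrt (T - t))
    (x₀ : EuclideanSpace ℝ (Fin 3)) (hnotbd : ¬ IsBackwardBoundedAt u T x₀)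
    {b : ℝ → ℝ} (hbm : Measurable b) {δb ρb q K₀ : ℝ} (hδb : 0 < δb) (hρb : 0 < ρb) (hK₀ : 0 ≤ K₀)
    (hb : ∀ t ∈ Ioo (T - δb) T, ∀ x ∈ ball x₀ ρb, ‖u t x‖ ≤ b t)
    (hLM : ∀ t' t : ℝ, T - δb < t' → t' ≤ t → t < T →
      ∫⁻ τ in Ioo t' t, ENNReal.ofReal (b τ ^ 2) ≤
        ENNReal.ofReal (2 * q * Real.log ((T - t') / (T - t)) + K₀))
    (hq : q < 1) {ρ : ℝ} (hρ : 0 < ρ) :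
    ¬ MemLp (u T) 3 (volume.restrict (ball x₀ ρ)) := by
  intro htr
  obtain ⟨U, P, G, M, D₀, h1, h2, h3, hD, h4, h5, h6, β, hβ, hβwin⟩ :=
    extinctApexD_of_L3trace_unit_lm hT hsol hLH hC0 hrateT x₀ hnotbd hρ htr hbm hδb hρb hb hLM
  have hT1 : (-1 : ℝ) < 0 := by norm_num
  exact no_topSingular_of_aeLogMean_lt_one (T := -1) h1 h2 h3 hD h4 h5 hT1 hK₀
    (ae_restrict_of_ae_restrict_of_subset (prod_mono (fun s hs => hs.2) subset_rfl) hβ)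
    (fun s' hs' s hs h => hβwin s' s h hs.2) hq 0 h6

end Summit.NavierStokesRegularity.NavierStokesRegularity.Theorems.TypeITraceScarL3

end
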